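import Mathlib.Tactic.Group
import Literature.AnabelianGeometry.SemiGraphs.ArithTemperedGroupOfOuterAction
import HarnessLib

/-!
# [SemiAnbd] Prop 5.2 (iv) / Thm 5.4, producer row T54-B (GAP-LEDGER G-w4d053-1), group half — sequel:
# the BRANCH-GRANULAR chart action (BR) for `Π^temp_𝔊 := π₁^temp(𝒢) ⋊^out Π_A`

Mochizuki, *Semi-graphs of anabelioids*, Publ. RIMS **42** (2006), §5 Def 5.1 (i) p. 62, Prop 5.2 (iv)
p. 64, p. 65 ll. 4–14 [cite: MochizukiSemiAnbd2006, Def 5.1 (i), p. 62].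

PROOF-ONLY sequel (no definitions) of `ArithTemperedGroupOfOuterAction.lean` (p416276, abc-iut-w4-d082):
abc-iut-w4-d040's LEVEL-A consumers of [SemiAnbd] Thm 5.4 (`hconjPair`, H-CE, `hcomm_b`, `hβ₁/hβ₂` of
sub-DAG `plan/L3/SUBDAG-SemiAnbd-Thm54.md`) need conjugation by `g ∈ Π^temp_𝔊` to carry the PAIR
(a verticial host at `v` given by a verticial homomorphism `φ` and an inner translate `x`, its
`b`-branch group `x · φ(Π_b) · x⁻¹`) to the corresponding PAIR at `(aug g) • v` with branch
`(aug g) • b` — vertex/edge granularity alone (`ArithChartAction.conj_verticial/conj_edgeLike`) cannot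
tell the two hosts of a LOOP apart (w4-d040, STATUS 2026-08-26 «THE ONE BRANCH-GRANULAR CLAUSE»).
For the outer semi-direct product model this is, by the conjugation formula
`conjSubgroup g (H.map ι) = (g.1.1 H).map ι`, a statement about the `Aut`-component of `g`; it is
DISCHARGED here (`conj_branchPair_outerAction`, exactly d040's shape (BR)) from the PAIR-LEVEL form of
the Prop 3.6 (iv)-at-`ρ_𝔾(a)` binder (`hBR`, ∃-representative form at `x = 1`; the proof upgrades it
to every representative of `ρ (aug g)` and every inner translate `x`).  Honest scope as in the parent
file: the binder itself (derivable from an action of `Π_A` on the anabelioid data of `𝒢` via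
abc-iut-L3-t10's `Hom.conj_of_chartPullbackWith_iso`) and the tempered topology are NOT supplied here.
No side taken on [IUTchIII] Cor 3.12; typed ≠ proved.
-/

namespace Literature.AnabelianGeometry.SemiGraphs

open Literature.AnabelianGeometry.EtaleTheta
open CategoryTheory

universe u w

/-! ### (BR) for the outer semi-direct product

abc-iut-w4-d040's LEVEL-A consumers (`hconjPair`, H-CE, `hcomm_b`, `hβ₁/hβ₂`) need conjugation by
`g ∈ Π^temp_𝔊` to carry the PAIR (a verticial host at `v`, its `b`-branch group) to the PAIR at
`(aug g) • v` with branch `(aug g) • b` — vertex/edge granularity alone cannot tell the two hosts of a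
loop apart.  For `Π^temp_𝔊 := π₁^temp(𝒢) ⋊^out Π_A` this is, by the conjugation formula, a statement
about the `Aut`-component of `g`; it is DISCHARGED here from the pair-level form of the
Prop 3.6 (iv)-at-`ρ_𝔾(a)` binder (`hBR`, ∃-representative form — the file upgrades it to every
representative and every inner translate `x`). -/

section BranchPair

variable {G : Type*} [Group G]

/-- Transport of a subgroup through an automorphism and an inner automorphism: if `Φ = conj h ∘ Φ₀`
then `Φ (x K x⁻¹) = (Φ x · h) · Φ₀(K) · (Φ x · h)⁻¹`. [folklore] -/
private theorem map_conj_map_mulAut_eq (Φ Φ₀ : MulAut G) (h : G) (hΦ : ∀ t, Φ t = h * Φ₀ t * h⁻¹)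
    (K : Subgroup G) (x : G) :
    (K.map (MulAut.conj x).toMonoidHom).map Φ.toMonoidHom =
      (K.map Φ₀.toMonoidHom).map (MulAut.conj (Φ x * h)).toMonoidHom := by
  rw [Subgroup.map_map, Subgroup.map_map]
  congr 1
  ext t
  simp only [MonoidHom.coe_comp, MulEquiv.coe_toMonoidHom, Function.comp_apply, MulAut.conj_apply]
  rw [map_mul, map_mul, map_inv, hΦ t]
  group

/-- Composition of inner automorphisms on subgroups: `y (x' K x'⁻¹) y⁻¹ = (y x') K (y x')⁻¹`. [folklore] -/
private theorem map_conj_map_conj (K : Subgroup G) (x' y : G) :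
    (K.map (MulAut.conj x').toMonoidHom).map (MulAut.conj y).toMonoidHom =
      K.map (MulAut.conj (y * x')).toMonoidHom := by
  rw [Subgroup.map_map]
  congr 1
  ext t
  simp only [MonoidHom.coe_comp, MulEquiv.coe_toMonoidHom, Function.comp_apply, MulAut.conj_apply]
  group

end BranchPair

namespace ProfiniteSemiGraph

variable {𝒢 : ProfiniteSemiGraph.{u}} (c : TemperedPiChart 𝒢)
  {PA : Type w} [Group PA] (ρ : PA →* TopOut c.G) (baseAct : PA →* Aut 𝒢.graph)

/-- **(BR) — the branch-granular chart action, DISCHARGED for `Π^temp_𝔊 := π₁^temp(𝒢) ⋊^out Π_A`**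
(abc-iut-w4-d040's clause `conj_branchPair`, Prop 3.6 (iv) at `ρ_𝔾(aug g)` read on pairs): for every
`g`, every branch `b` abutting to `v`, every verticial homomorphism `φ` at `v` and every `x ∈ π₁^temp(𝒢)`,
conjugation by `g` carries `ι(x · φ(Π_v) · x⁻¹)` to `ι(x' · φ'(Π_{a•v}) · x'⁻¹)` AND
`ι(x · φ(Π_b) · x⁻¹)` to `ι(x' · φ'(Π_{a•b}) · x'⁻¹)` for some verticial `φ'` at `a • v` and some `x'`
(`a = aug g`; `Π_b = branchSubgroup b v`), GIVEN the pair-level binder `hBR`: SOME representative `Φ`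
of `ρ a` does so for `x = 1`. [cite: MochizukiSemiAnbd2006, Def 5.1 (i), p. 62] -/
theorem conj_branchPair_outerAction
    (hBR : ∀ (a : PA) (b : 𝒢.graph.Branch) (v : 𝒢.graph.Vertex) (hb : 𝒢.graph.abuts b = some v)
      (φ : 𝒢.Gv v →ₜ* c.G), IsVerticialHom c v φ →
      ∃ Φ : contMulAut c.G, TopOut.mk c.G Φ = ρ a ∧
        ∃ φ' : 𝒢.Gv ((baseAct a).hom.vertexMap v) →ₜ* c.G,
          IsVerticialHom c ((baseAct a).hom.vertexMap v) φ' ∧ ∃ x' : c.G,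
            Subgroup.map (Φ : MulAut c.G).toMonoidHom φ.toMonoidHom.range =
              Subgroup.map (MulAut.conj x').toMonoidHom φ'.toMonoidHom.range ∧
            Subgroup.map (Φ : MulAut c.G).toMonoidHom
                (Subgroup.map φ.toMonoidHom (𝒢.branchSubgroup b v hb)) =
              Subgroup.map (MulAut.conj x').toMonoidHom
                (Subgroup.map φ'.toMonoidHom
                  (𝒢.branchSubgroup ((baseAct a).hom.branchMap b) ((baseAct a).hom.vertexMap v)
                    ((baseAct a).hom.abuts_branchMap b v hb))))
    (g : outerSemidirectProduct ρ) (b : 𝒢.graph.Branch) (v : 𝒢.graph.Vertex)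
    (hb : 𝒢.graph.abuts b = some v) (φ : 𝒢.Gv v →ₜ* c.G) (hφ : IsVerticialHom c v φ) (x : c.G) :
    ∃ φ' : 𝒢.Gv ((baseAct (outerSemidirectProductSnd ρ g)).hom.vertexMap v) →ₜ* c.G,
      IsVerticialHom c ((baseAct (outerSemidirectProductSnd ρ g)).hom.vertexMap v) φ' ∧ ∃ x' : c.G,
        conjSubgroup g (Subgroup.map (toOuterSemidirectProduct ρ)
            (Subgroup.map (MulAut.conj x).toMonoidHom φ.toMonoidHom.range)) =
          Subgroup.map (toOuterSemidirectProduct ρ)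
            (Subgroup.map (MulAut.conj x').toMonoidHom φ'.toMonoidHom.range) ∧
        conjSubgroup g (Subgroup.map (toOuterSemidirectProduct ρ)
            (Subgroup.map (MulAut.conj x).toMonoidHom
              (Subgroup.map φ.toMonoidHom (𝒢.branchSubgroup b v hb)))) =
          Subgroup.map (toOuterSemidirectProduct ρ)
            (Subgroup.map (MulAut.conj x').toMonoidHom
              (Subgroup.map φ'.toMonoidHom
                (𝒢.branchSubgroup ((baseAct (outerSemidirectProductSnd ρ g)).hom.branchMap b)
                  ((baseAct (outerSemidirectProductSnd ρ g)).hom.vertexMap v)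
                  ((baseAct (outerSemidirectProductSnd ρ g)).hom.abuts_branchMap b v hb)))) := by
  obtain ⟨Φ₀, hΦ₀, φ', hφ', x', h1, h2⟩ := hBR (outerSemidirectProductSnd ρ g) b v hb φ hφ
  -- the `Aut`-component of `g` is another representative of the same outer class
  obtain ⟨h, hh⟩ := exists_conj_of_mk_eq Φ₀ g.1.1 (hΦ₀.trans (mk_fst_eq_rho_snd ρ g).symm)
  refine ⟨φ', hφ', (g.1.1 : MulAut c.G) x * h * x', ?_, ?_⟩
  · rw [conjSubgroup_map_toOuterSemidirectProduct, map_conj_map_mulAut_eq _ _ h hh, h1,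
      map_conj_map_conj]
  · rw [conjSubgroup_map_toOuterSemidirectProduct, map_conj_map_mulAut_eq _ _ h hh, h2,
      map_conj_map_conj]

end ProfiniteSemiGraph

end Literature.AnabelianGeometry.SemiGraphs
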